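import Literature.Probability.LatticeModels.TemperleyLiebLinkPatterns
import HarnessLib

/-!
# A link pattern is determined by its set of opening sites (Dyck-word injectivity)

Topic `Literature/Probability/LatticeModels`; a rider on `TemperleyLiebLinkPatterns.lean` (Pearce–Rittenberg–de Gier–Nienhuis 2002: pairings `PerfectMatching L`, planarity
`IsNonCrossing`, `LinkPattern L`). The classical bijection «link patterns (non-intersecting half-loops) ↔ Dyck paths / ballot sequences» underlies the Catalan count of
the `0`-defect sector (PRdGN §2, `C_{L,m}`; the marked-loop lineage's `MarkedLoopCatalan.lean` proves the COUNT by Segner's recursion). This file proves the INJECTIVITY half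
in the form the lane's door-(U) programme needs ((T3) of the «skyline» strategy, HOME `FINDING-TRIPOD-DOOR-U-TWO-CORNER.md` §4):

* `PerfectMatching.IsOpener p j` — `j` is an OPENING site (`j < partner j`); `isOpener_partner_iff` (the partner of an opening site closes, and conversely);
* `IsNonCrossing.partner_mem_Ioo` — under a chord `(x, p x)` every inner site has its partner inside (the planarity clause, repackaged);
* ★★★ `LinkPattern.eq_of_isOpener_iff` — **TWO LINK PATTERNS WITH THE SAME OPENING SITES ARE EQUAL** (the Dyck word determines the non-crossing pairing). Proof by a minimal
  counterexample and a count, no induction on `L`: at the least site `x` where the partners differ, `x` opens in both, say to `y < z`; inside the chord `(x, y)` of the first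
  pattern openers and closers balance, and the second pattern would have to close the `#closers + 1` sites of `(x, y]` onto the openers of `(x, y)` injectively.

## References
* P. A. Pearce, V. Rittenberg, J. de Gier, B. Nienhuis, J. Phys. A 35 (2002) L661–L668, §2 (link patterns, «non-intersecting half-loops», `C_{L,m}`).
* R. P. Grimaldi, *Fibonacci and Catalan Numbers* (2012), Ch. 32, Example 32.3 (non-intersecting chords ↔ Catalan structures).

## Mathlib / tree
Tree: `TemperleyLiebLinkPatterns.lean` (`PerfectMatching`, `partner_partner`, `partner_ne`, `partner_inj`, `IsNonCrossing`, `LinkPattern`). Mathlib: `Nat.find`, `Finset.card_le_card_of_injOn`,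
`Finset.card_nbij`, `Finset.filter`.
-/

namespace Literature.Probability.LatticeModels.TemperleyLieb

open Finset

variable {L : ℕ}

namespace PerfectMatching

/-- `j` is an **opening site** of the pairing: its partner lies to the right. [cite: PearceRittenbergDeGierNienhuis2002, §2 (link patterns as half-loops)] -/
def IsOpener (p : PerfectMatching L) (j : Fin L) : Prop := j < p.partner j

/-- a site that does not open closes (no site is its own partner). [cite: PearceRittenbergDeGierNienhuis2002, §2] -/
theorem partner_lt_of_not_isOpener (p : PerfectMatching L) {j : Fin L} (h : ¬ p.IsOpener j) : p.partner j < j :=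
  lt_of_le_of_ne (not_lt.1 h) (p.partner_ne j)

/-- the partner of an opening site closes, and conversely. [cite: PearceRittenbergDeGierNienhuis2002, §2] -/
theorem isOpener_partner_iff (p : PerfectMatching L) (j : Fin L) : p.IsOpener (p.partner j) ↔ ¬ p.IsOpener j := by
  unfold IsOpener
  rw [p.partner_partner, not_lt]
  exact ⟨fun h => h.le, fun h => lt_of_le_of_ne h (p.partner_ne j)⟩

end PerfectMatching

/-- **under a chord every inner site has its partner inside** (planarity, repackaged): if `x < v < p x` then `x < p v < p x`.
[cite: PearceRittenbergDeGierNienhuis2002, §2 (non-intersecting half-loops)] -/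
theorem IsNonCrossing.partner_mem_Ioo {p : PerfectMatching L} (hp : IsNonCrossing p) {x v : Fin L} (hx : x < p.partner x) (h1 : x < v) (h2 : v < p.partner x) :
    x < p.partner v ∧ p.partner v < p.partner x :=
  hp x v hx h1 h2

/-- ★★★ **A LINK PATTERN IS DETERMINED BY ITS OPENING SITES** (Dyck-word injectivity): two non-crossing pairings of `Fin L` with the same set of opening sites are equal.
[cite: PearceRittenbergDeGierNienhuis2002, §2 (link patterns, `C_{L,m}`); Grimaldi2012, Ex. 32.3] -/
theorem LinkPattern.eq_of_isOpener_iff (P Q : LinkPattern L) (h : ∀ j : Fin L, P.1.IsOpener j ↔ Q.1.IsOpener j) : P = Q := by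
  classical
  by_contra hne
  -- a least site where the partners differ
  have hex : ∃ j : Fin L, P.1.partner j ≠ Q.1.partner j :=
    not_forall.1 fun hall => hne (Subtype.ext (PerfectMatching.ext (funext hall)))
  let D : Finset (Fin L) := Finset.univ.filter fun j => P.1.partner j ≠ Q.1.partner j
  have hD : D.Nonempty := by
    obtain ⟨j, hj⟩ := hex
    exact ⟨j, Finset.mem_filter.2 ⟨Finset.mem_univ _, hj⟩⟩
  have hx : P.1.partner (D.min' hD) ≠ Q.1.partner (D.min' hD) := (Finset.mem_filter.1 (Finset.min'_mem D hD)).2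
  have hmin : ∀ j : Fin L, j < D.min' hD → P.1.partner j = Q.1.partner j := fun j hj => by
    by_contra hne'
    exact not_lt.2 (Finset.min'_le D j (Finset.mem_filter.2 ⟨Finset.mem_univ _, hne'⟩)) hj
  set x := D.min' hD with hxdef
  -- `x` opens in both patterns: a closing `x` has its partner below `x`, where the patterns agree
  have hxup : P.1.IsOpener x := by
    by_contra hdown
    have hy : P.1.partner x < x := P.1.partner_lt_of_not_isOpener hdown
    have h1 : P.1.partner (P.1.partner x) = Q.1.partner (P.1.partner x) := hmin _ hy
    rw [P.1.partner_partner] at h1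
    -- so `Q (P x) = x`, i.e. `Q x = P x`
    have h2 : Q.1.partner x = P.1.partner x := by
      have := congrArg Q.1.partner h1
      rw [Q.1.partner_partner] at this
      exact this
    exact hx h2.symm
  have hxupQ : Q.1.IsOpener x := (h x).1 hxup
  -- the generic contradiction, for an ordered pair of candidates
  have key : ∀ (A B : LinkPattern L), (∀ j : Fin L, A.1.IsOpener j ↔ B.1.IsOpener j) → (∀ j : Fin L, j < x → A.1.partner j = B.1.partner j) →
      A.1.IsOpener x → A.1.partner x < B.1.partner x → False := by
    intro A B hAB hminAB hAx hyz
    set y := A.1.partner x with hy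
    -- closers of `(x, y]` and openers of `(x, y)` in `A` (= in `B`)
    let S : Finset (Fin L) := Finset.univ.filter fun v => x < v ∧ v ≤ y ∧ ¬ A.1.IsOpener v
    let T : Finset (Fin L) := Finset.univ.filter fun u => x < u ∧ u < y ∧ A.1.IsOpener u
    -- (1) `#S = #T + 1`: `A.partner` is a bijection from the closers of `(x, y)` onto the openers of `(x, y)`, and `y` closes
    have hyA : ¬ A.1.IsOpener y := by rw [hy, A.1.isOpener_partner_iff]; exact not_not.2 hAx
    have hST : S.card = T.card + 1 := by
      have hS : S = insert y (Finset.univ.filter fun v => x < v ∧ v < y ∧ ¬ A.1.IsOpener v) := by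
        ext v
        simp only [S, Finset.mem_filter, Finset.mem_univ, true_and, Finset.mem_insert]
        constructor
        · rintro ⟨h1, h2, h3⟩
          rcases lt_or_eq_of_le h2 with h2 | h2
          · exact Or.inr ⟨h1, h2, h3⟩
          · exact Or.inl h2
        · rintro (rfl | ⟨h1, h2, h3⟩)
          · exact ⟨hAx, le_rfl, hyA⟩
          · exact ⟨h1, h2.le, h3⟩
      rw [hS, Finset.card_insert_of_notMem (by simp)]
      congr 1
      apply Finset.card_nbij (fun v => A.1.partner v)
      · intro v hv
        rw [Finset.mem_coe, Finset.mem_filter] at hv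
        obtain ⟨-, h1, h2, h3⟩ := hv
        rw [Finset.mem_coe, Finset.mem_filter]
        obtain ⟨h4, h5⟩ := A.2.partner_mem_Ioo hAx h1 h2
        exact ⟨Finset.mem_univ _, h4, h5, (A.1.isOpener_partner_iff v).2 h3⟩
      · intro v _ v' _ hvv
        exact A.1.partner_inj.1 hvv
      · intro u hu
        rw [Finset.mem_coe, Finset.mem_filter] at hu
        obtain ⟨-, h1, h2, h3⟩ := hu
        obtain ⟨h4, h5⟩ := A.2.partner_mem_Ioo hAx h1 h2
        refine ⟨A.1.partner u, ?_, A.1.partner_partner u⟩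
        rw [Finset.mem_coe, Finset.mem_filter]
        exact ⟨Finset.mem_univ _, h4, h5, fun h6 => ((A.1.isOpener_partner_iff u).1 h6) h3⟩
    -- (2) `B.partner` maps `S` injectively into `T`
    have hmap : ∀ v ∈ S, B.1.partner v ∈ T := by
      intro v hv
      rw [Finset.mem_filter] at hv
      obtain ⟨-, h1, h2, h3⟩ := hv
      have h3B : ¬ B.1.IsOpener v := fun h6 => h3 ((hAB v).2 h6)
      have hwv : B.1.partner v < v := B.1.partner_lt_of_not_isOpener h3B
      have hwup : B.1.IsOpener (B.1.partner v) := (B.1.isOpener_partner_iff v).2 h3B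
      rw [Finset.mem_filter]
      refine ⟨Finset.mem_univ _, ?_, lt_of_lt_of_le hwv h2 |>.trans_le le_rfl |> fun h => lt_of_lt_of_le hwv h2, (hAB _).2 hwup⟩
      -- `x < B v`: `B v = x` is impossible (`B x = z > y ≥ v`), `B v < x` contradicts minimality through `A`
      rcases lt_trichotomy (B.1.partner v) x with hlt | heq | hgt
      · exfalso
        have h7 : A.1.partner (B.1.partner v) = B.1.partner (B.1.partner v) := hminAB _ hlt
        rw [B.1.partner_partner] at h7
        -- `A (B v) = v`, so `A v = B v < x`; but `v ∈ (x, y]` has its `A`-partner in `[x, y)`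
        have h8 : A.1.partner v = B.1.partner v := by
          have := congrArg A.1.partner h7; rw [A.1.partner_partner] at this; exact this.symm
        rcases lt_or_eq_of_le h2 with h2' | h2'
        · have := (A.2.partner_mem_Ioo hAx h1 h2').1
          rw [h8] at this
          exact lt_asymm this hlt
        · have : A.1.partner v = x := by rw [h2', hy, A.1.partner_partner]
          rw [h8] at this
          exact (ne_of_lt hlt) this
      · exfalso
        have : B.1.partner x = v := by rw [← heq, B.1.partner_partner]
        have h9 : v ≤ y := h2
        rw [← this] at h9
        exact not_lt.2 h9 hyz
      · exact hgt
    have hinj : Set.InjOn (fun v => B.1.partner v) S := fun v _ v' _ hvv => B.1.partner_inj.1 hvv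
    have hle : S.card ≤ T.card := Finset.card_le_card_of_injOn _ hmap hinj
    omega
  -- apply `key` to the ordered pair
  rcases lt_trichotomy (P.1.partner x) (Q.1.partner x) with hlt | heq | hgt
  · exact key P Q h hmin hxup hlt
  · exact hx heq
  · exact key Q P (fun j => (h j).symm) (fun j hj => (hmin j hj).symm) hxupQ hgt

end Literature.Probability.LatticeModels.TemperleyLieb
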